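import Mathlib
import HarnessLib

/-!
# Completed monoid algebras `R⟦P⟧` of monoids of exponents (power series supported on a submonoid)

`Literature/RingTheory/MvPowerSeries/MonoidPowerSeries.lean`. For a commutative ring `R` and an
additive submonoid `P ⊆ ℕ^{(σ)}` of exponent vectors, the formal power series
`∑_{e ∈ P} a_e x^e ∈ R⟦x_s : s ∈ σ⟧` SUPPORTED ON `P` form an `R`-subalgebra
`monoidPowerSeries R P ⊆ MvPowerSeries σ R`: the **completed monoid algebra** `R⟦P⟧` of `P`
(K. Kato, *Toric singularities*, Amer. J. Math. 116 (1994), §3, where `R[[P]]` for a finitely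
generated integral monoid `P` with `P^× = {1}` is realised inside `R[[ℕ^s]]` through an injection
`P → ℕ^s` (proof of Lemma (3.4)); Gabber–Ramero, *Foundations for almost ring theory*, §6.5, the
`𝔪_P`-adic completion of `R[P]`). Everything here is PROVED; the only definitions are
`monoidPowerSeries` and the push-forward `pushforward` along a homomorphism of
exponent monoids with finite fibres.

* `monoidPowerSeries R P` — the subalgebra; `mem_monoidPowerSeries_iff`, `monomial_mem`.
* `mem_of_mul_eq_one`, `isUnit_iff_isUnit_constantCoeff` — a series supported on `P` that is a
  unit of `R⟦x⟧` has its inverse supported on `P`; hence (`isLocalRing`) `R⟦P⟧` is a local ring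
  when `R` is, with residue field that of `R` (Kato §3: `R[[P]]` is local with maximal ideal
  `(𝔪_R, P ∖ {0})`).
* `pushforward` — for an additive map `c : P → ℕ^{(τ)}` with finite fibres, the `R`-algebra
  homomorphism `R⟦P⟧ → R⟦y_t : t ∈ τ⟧`, `∑ a_e x^e ↦ ∑ a_e y^{c(e)}` (used by Kato with `c` an
  injection `P → ℕ^s`; finite fibres is what makes the infinite sums meaningful), with
  `coeff_pushforward`, `pushforward_monomial`, `pushforward_mem`.

What is NOT here: topology / adic completeness of `R⟦P⟧`, Noetherianity, the identification with
the `(𝔪_R, P⁺)`-adic completion of the monoid algebra `R[P]`, Kato's Lemmas (3.4)/(3.5).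

References: [Kato1994] K. Kato, Toric singularities, Amer. J. Math. 116 (1994) 1073–1099, §3
(the rings `R[[P]]`, Lemmas (3.4), (3.5)); Gabber–Ramero, Foundations for almost ring theory,
arXiv:math/0409584, §6.5.
-/

noncomputable section

open MvPowerSeries

namespace Literature.RingTheory.MvPowerSeries

universe u v w

variable {σ : Type u} (R : Type v) [CommRing R]

/-- The **completed monoid algebra `R⟦P⟧`** of an additive submonoid `P ⊆ ℕ^{(σ)}` of exponents:
the `R`-subalgebra of `R⟦x_s : s ∈ σ⟧ = MvPowerSeries σ R` of the power series whose coefficients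
vanish outside `P` (series "supported on `P`"). It is closed under multiplication because
`a + b ∉ P` forces `a ∉ P` or `b ∉ P`. [cite: Kato1994, §3 (proof of Lemma 3.4)] -/
def monoidPowerSeries (P : AddSubmonoid (σ →₀ ℕ)) : Subalgebra R (MvPowerSeries σ R) where
  carrier := {f | ∀ e, e ∉ P → MvPowerSeries.coeff e f = 0}
  mul_mem' {f g} hf hg := by
    classical
    intro e he
    rw [MvPowerSeries.coeff_mul]
    refine Finset.sum_eq_zero fun x hx => ?_
    rw [Finset.HasAntidiagonal.mem_antidiagonal] at hx
    by_cases h1 : x.1 ∈ P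
    · have h2 : x.2 ∉ P := fun h2 => he (hx ▸ P.add_mem h1 h2)
      rw [hg _ h2, mul_zero]
    · rw [hf _ h1, zero_mul]
  one_mem' := by
    classical
    intro e he
    rw [MvPowerSeries.coeff_one, if_neg]
    rintro rfl
    exact he P.zero_mem
  add_mem' {f g} hf hg := by
    intro e he
    rw [map_add, hf e he, hg e he, add_zero]
  zero_mem' := by
    intro e _
    rw [map_zero]
  algebraMap_mem' r := by
    classical
    intro e he
    rw [MvPowerSeries.algebraMap_apply, Algebra.algebraMap_self, RingHom.id_apply,
      MvPowerSeries.coeff_C, if_neg]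
    rintro rfl
    exact he P.zero_mem

variable {R}

namespace monoidPowerSeries

section Basic
variable {P : AddSubmonoid (σ →₀ ℕ)}

/-- Membership in `R⟦P⟧`: the coefficients vanish off `P`. [cite: Kato1994, §3] -/
theorem mem_monoidPowerSeries_iff {f : MvPowerSeries σ R} :
    f ∈ monoidPowerSeries R P ↔ ∀ e, e ∉ P → MvPowerSeries.coeff e f = 0 := Iff.rfl

/-- Coefficients of an element of `R⟦P⟧` vanish outside `P`. [cite: Kato1994, §3] -/
theorem coeff_eq_zero_of_mem {f : MvPowerSeries σ R} (hf : f ∈ monoidPowerSeries R P)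
    {e : σ →₀ ℕ} (he : e ∉ P) : MvPowerSeries.coeff e f = 0 := hf e he

/-- Monomials with exponent in `P` lie in `R⟦P⟧`. [cite: Kato1994, §3] -/
theorem monomial_mem {p : σ →₀ ℕ} (hp : p ∈ P) (r : R) :
    MvPowerSeries.monomial p r ∈ monoidPowerSeries R P := by
  classical
  intro e he
  rw [MvPowerSeries.coeff_monomial, if_neg]
  rintro rfl
  exact he hp

/-- Constants lie in `R⟦P⟧`. [cite: Kato1994, §3] -/
theorem C_mem (r : R) : MvPowerSeries.C r ∈ monoidPowerSeries R P := by
  classical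
  intro e he
  rw [MvPowerSeries.coeff_C, if_neg]
  rintro rfl
  exact he P.zero_mem

/-- `R⟦P⟧` is monotone in `P`. [cite: Kato1994, §3] -/
theorem mono {P Q : AddSubmonoid (σ →₀ ℕ)} (h : P ≤ Q) :
    monoidPowerSeries R P ≤ monoidPowerSeries R Q := fun _ hf e he => hf e fun hp => he (h hp)

/-! ### Units: the inverse of a unit supported on `P` is supported on `P` -/

/-- If `f ∈ R⟦P⟧` and `f * g = 1` in `R⟦x⟧`, then `g ∈ R⟦P⟧`: comparing coefficients at a
minimal `e ∉ P` (induction on the degree of `e`), `f₀ g_e = 0` with `f₀` a unit.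
[cite: Kato1994, §3] -/
theorem mem_of_mul_eq_one {f g : MvPowerSeries σ R} (hf : f ∈ monoidPowerSeries R P)
    (hfg : f * g = 1) : g ∈ monoidPowerSeries R P := by
  classical
  -- the constant coefficient of `f` is a unit
  have hunit : IsUnit (MvPowerSeries.constantCoeff f) := by
    have h := congrArg MvPowerSeries.constantCoeff hfg
    rw [map_mul, map_one] at h
    exact isUnit_iff_exists_inv.2 ⟨_, h⟩
  -- strong induction on the degree of the exponent
  suffices H : ∀ n : ℕ, ∀ e : σ →₀ ℕ, e.degree = n → e ∉ P → MvPowerSeries.coeff e g = 0 from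
    fun e he => H _ e rfl he
  intro n
  induction n using Nat.strong_induction_on with
  | _ n ih =>
    intro e hen he
    have he0 : e ≠ 0 := by
      rintro rfl
      exact he P.zero_mem
    have hcoeff : MvPowerSeries.coeff e (f * g) = 0 := by
      rw [hfg, MvPowerSeries.coeff_one, if_neg he0]
    rw [MvPowerSeries.coeff_mul, Finset.sum_eq_single (0, e)] at hcoeff
    · rw [MvPowerSeries.coeff_zero_eq_constantCoeff] at hcoeff
      exact (hunit.mul_right_eq_zero).1 hcoeff
    · rintro ⟨a, b⟩ hab hne
      rw [Finset.HasAntidiagonal.mem_antidiagonal] at hab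
      dsimp only at hab ⊢
      by_cases ha0 : a = 0
      · subst ha0
        rw [zero_add] at hab
        subst hab
        exact (hne rfl).elim
      by_cases haP : a ∈ P
      · have hbP : b ∉ P := fun hbP => he (hab ▸ P.add_mem haP hbP)
        have hdeg : b.degree < n := by
          rw [← hen, ← hab, map_add]
          have : 0 < a.degree := Nat.pos_of_ne_zero fun h => ha0 ((Finsupp.degree_eq_zero_iff a).1 h)
          omega
        rw [ih _ hdeg b rfl hbP, mul_zero]
      · rw [hf a haP, zero_mul]
    · intro h
      exact (h (Finset.HasAntidiagonal.mem_antidiagonal.2 (zero_add e))).elim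

/-- An element of `R⟦P⟧` is a unit of `R⟦P⟧` iff its constant coefficient is a unit of `R`
(iff it is a unit of `R⟦x⟧`). [cite: Kato1994, §3] -/
theorem isUnit_iff_isUnit_constantCoeff (f : monoidPowerSeries R P) :
    IsUnit f ↔ IsUnit (MvPowerSeries.constantCoeff (f : MvPowerSeries σ R)) := by
  constructor
  · intro h
    exact MvPowerSeries.isUnit_constantCoeff _ (h.map (monoidPowerSeries R P).val)
  · intro h
    have hu : IsUnit (f : MvPowerSeries σ R) := MvPowerSeries.isUnit_iff_constantCoeff.2 h
    obtain ⟨u, hu⟩ := hu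
    have h1 : (f : MvPowerSeries σ R) * ↑u⁻¹ = 1 := by rw [← hu]; exact u.mul_inv
    have h2 : ↑u⁻¹ * (f : MvPowerSeries σ R) = 1 := by rw [← hu]; exact u.inv_mul
    have hinv : (↑u⁻¹ : MvPowerSeries σ R) ∈ monoidPowerSeries R P := mem_of_mul_eq_one f.2 h1
    refine ⟨⟨f, ⟨↑u⁻¹, hinv⟩, Subtype.ext h1, Subtype.ext h2⟩, rfl⟩

/-- `R⟦P⟧` is a local ring when `R` is: a unit is detected on the constant coefficient.
[cite: Kato1994, §3] -/
theorem isLocalRing [IsLocalRing R] : IsLocalRing (monoidPowerSeries R P) := by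
  haveI : Nontrivial (monoidPowerSeries R P) :=
    (monoidPowerSeries R P).val.toRingHom.domain_nontrivial
  refine IsLocalRing.of_isUnit_or_isUnit_one_sub_self fun a => ?_
  have h : MvPowerSeries.constantCoeff (a : MvPowerSeries σ R) +
      MvPowerSeries.constantCoeff ((1 - a : monoidPowerSeries R P) : MvPowerSeries σ R) = 1 := by
    rw [← map_add, ← Subalgebra.coe_add, add_sub_cancel, Subalgebra.coe_one, map_one]
  rcases IsLocalRing.isUnit_or_isUnit_of_add_one h with h | h
  · exact Or.inl ((isUnit_iff_isUnit_constantCoeff a).2 h)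
  · exact Or.inr ((isUnit_iff_isUnit_constantCoeff (1 - a)).2 h)

/-- The non-units of the local ring `R⟦P⟧` (`R` local) are the series with constant coefficient
in `𝔪_R`. [cite: Kato1994, §3] -/
theorem mem_maximalIdeal_iff [IsLocalRing R] (f : monoidPowerSeries R P) :
    haveI := isLocalRing (R := R) (P := P)
    f ∈ IsLocalRing.maximalIdeal (monoidPowerSeries R P) ↔
      MvPowerSeries.constantCoeff (f : MvPowerSeries σ R) ∈ IsLocalRing.maximalIdeal R := by
  haveI := isLocalRing (R := R) (P := P)
  rw [IsLocalRing.mem_maximalIdeal, IsLocalRing.mem_maximalIdeal, mem_nonunits_iff,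
    mem_nonunits_iff, isUnit_iff_isUnit_constantCoeff]

end Basic

/-! ### Push-forward along a homomorphism of exponent monoids with finite fibres -/

section Pushforward

variable {τ : Type w} {P : AddSubmonoid (σ →₀ ℕ)} (c : (σ →₀ ℕ) → (τ →₀ ℕ))
  (hfin : ∀ e : τ →₀ ℕ, {p : σ →₀ ℕ | p ∈ P ∧ c p = e}.Finite)

/-- The push-forward of a series along `c`, on coefficient functions:
`(c_* f)_e = ∑_{p ∈ P, c p = e} f_p` (a finite sum by hypothesis). Only the values of `c` on `P`
matter. [cite: Kato1994, §3] -/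
def pushforwardFun (f : MvPowerSeries σ R) : MvPowerSeries τ R :=
  fun e => ∑ p ∈ (hfin e).toFinset, MvPowerSeries.coeff p f

/-- Coefficients of the push-forward. [cite: Kato1994, §3] -/
theorem coeff_pushforwardFun (f : MvPowerSeries σ R) (e : τ →₀ ℕ) :
    MvPowerSeries.coeff e (pushforwardFun (R := R) c hfin f) =
      ∑ p ∈ (hfin e).toFinset, MvPowerSeries.coeff p f :=
  rfl

omit [CommRing R] in
/-- Membership in the fibre Finset. [folklore] -/
private theorem mem_fibre_toFinset_iff {e : τ →₀ ℕ} {p : σ →₀ ℕ} :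
    p ∈ (hfin e).toFinset ↔ p ∈ P ∧ c p = e := by
  rw [Set.Finite.mem_toFinset, Set.mem_setOf_eq]

/-- The push-forward is additive. [folklore] -/
private theorem pushforwardFun_add (f g : MvPowerSeries σ R) :
    pushforwardFun (R := R) c hfin (f + g) = pushforwardFun c hfin f + pushforwardFun c hfin g := by
  ext e
  simp only [map_add, coeff_pushforwardFun, Finset.sum_add_distrib]

/-- The push-forward of a constant is the constant (uses `c 0 = 0`). [folklore] -/
private theorem pushforwardFun_C (hc0 : c 0 = 0) (r : R) :
    pushforwardFun (R := R) c hfin (MvPowerSeries.C r) = MvPowerSeries.C r := by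
  classical
  ext e
  rw [coeff_pushforwardFun, MvPowerSeries.coeff_C]
  by_cases he : e = 0
  · subst he
    rw [if_pos rfl, Finset.sum_eq_single (0 : σ →₀ ℕ)]
    · rw [MvPowerSeries.coeff_C, if_pos rfl]
    · intro p _ hp
      rw [MvPowerSeries.coeff_C, if_neg hp]
    · intro h
      exact (h ((mem_fibre_toFinset_iff c hfin).2 ⟨P.zero_mem, hc0⟩)).elim
  · rw [if_neg he]
    refine Finset.sum_eq_zero fun p hp => ?_
    rw [MvPowerSeries.coeff_C, if_neg]
    rintro rfl
    exact he (((mem_fibre_toFinset_iff c hfin).1 hp).2.symm.trans hc0)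

/-- The push-forward of `1` is `1`. [folklore] -/
private theorem pushforwardFun_one (hc0 : c 0 = 0) : pushforwardFun (R := R) c hfin (1 : MvPowerSeries σ R) = 1 := by
  have h := pushforwardFun_C (R := R) c hfin hc0 1
  rwa [map_one] at h

include hfin in
/-- The finite set of pairs `(a, b) ∈ P × P` with `c a + c b = e`. [folklore] -/
private theorem finite_pairs (e : τ →₀ ℕ) :
    {x : (σ →₀ ℕ) × (σ →₀ ℕ) | x.1 ∈ P ∧ x.2 ∈ P ∧ c x.1 + c x.2 = e}.Finite := by
  classical
  refine Set.Finite.subset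
    ((Finset.HasAntidiagonal.antidiagonal e).finite_toSet.biUnion fun y _ => (hfin y.1).prod (hfin y.2)) ?_
  rintro ⟨a, b⟩ ⟨ha, hb, hab⟩
  simp only [Set.mem_iUnion, Finset.mem_coe, Finset.HasAntidiagonal.mem_antidiagonal, Set.mem_prod,
    Set.mem_setOf_eq, exists_prop, Prod.exists]
  exact ⟨c a, c b, hab, ⟨ha, rfl⟩, ⟨hb, rfl⟩⟩

/-- The push-forward is multiplicative ON `R⟦P⟧` (for `c` additive on `P`): both `(c_*(fg))_e` and
`(c_* f · c_* g)_e` equal `∑_{a, b ∈ P, c a + c b = e} f_a g_b`. [cite: Kato1994, §3] -/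
theorem pushforwardFun_mul (hadd : ∀ a ∈ P, ∀ b ∈ P, c (a + b) = c a + c b)
    {f g : MvPowerSeries σ R} (hf : f ∈ monoidPowerSeries R P) (hg : g ∈ monoidPowerSeries R P) :
    pushforwardFun (R := R) c hfin (f * g) = pushforwardFun c hfin f * pushforwardFun c hfin g := by
  classical
  ext e
  set U : Finset ((σ →₀ ℕ) × (σ →₀ ℕ)) := (finite_pairs c hfin e).toFinset with hU
  have hmemU : ∀ x : (σ →₀ ℕ) × (σ →₀ ℕ), x ∈ U ↔ x.1 ∈ P ∧ x.2 ∈ P ∧ c x.1 + c x.2 = e :=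
    fun x => by rw [hU, Set.Finite.mem_toFinset, Set.mem_setOf_eq]
  set F : (σ →₀ ℕ) × (σ →₀ ℕ) → R := fun x =>
    MvPowerSeries.coeff x.1 f * MvPowerSeries.coeff x.2 g with hF
  -- left-hand side = ∑_{x ∈ U} F x
  have hL : MvPowerSeries.coeff e (pushforwardFun (R := R) c hfin (f * g)) = ∑ x ∈ U, F x := by
    rw [coeff_pushforwardFun]
    have hinner : ∀ p ∈ (hfin e).toFinset, MvPowerSeries.coeff p (f * g) =
        ∑ x ∈ (Finset.HasAntidiagonal.antidiagonal p).filter (fun x => x.1 ∈ P ∧ x.2 ∈ P), F x := by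
      intro p _
      rw [MvPowerSeries.coeff_mul, Finset.sum_filter]
      refine Finset.sum_congr rfl fun x _ => ?_
      split_ifs with hx
      · rfl
      · rcases not_and_or.1 hx with h1 | h2
        · rw [hf _ h1, zero_mul]
        · rw [hg _ h2, mul_zero]
    rw [Finset.sum_congr rfl hinner, ← Finset.sum_biUnion]
    · refine Finset.sum_congr ?_ fun _ _ => rfl
      ext x
      simp only [Finset.mem_biUnion, Finset.mem_filter, Finset.HasAntidiagonal.mem_antidiagonal,
        mem_fibre_toFinset_iff, hmemU]
      constructor
      · rintro ⟨p, ⟨-, hcp⟩, hsum, h1, h2⟩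
        exact ⟨h1, h2, by rw [← hadd _ h1 _ h2, hsum, hcp]⟩
      · rintro ⟨h1, h2, hce⟩
        exact ⟨x.1 + x.2, ⟨P.add_mem h1 h2, by rw [hadd _ h1 _ h2, hce]⟩, rfl, h1, h2⟩
    · -- the filtered antidiagonals of distinct `p` are disjoint
      intro p _ q _ hpq
      refine Finset.disjoint_left.2 fun x hxp hxq => hpq ?_
      rw [Finset.mem_filter, Finset.HasAntidiagonal.mem_antidiagonal] at hxp hxq
      rw [← hxp.1, hxq.1]
  -- right-hand side = ∑_{x ∈ U} F x
  have hR : MvPowerSeries.coeff e (pushforwardFun (R := R) c hfin f * pushforwardFun c hfin g) =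
      ∑ x ∈ U, F x := by
    rw [MvPowerSeries.coeff_mul]
    have hinner : ∀ z ∈ Finset.HasAntidiagonal.antidiagonal e,
        MvPowerSeries.coeff z.1 (pushforwardFun (R := R) c hfin f) *
          MvPowerSeries.coeff z.2 (pushforwardFun (R := R) c hfin g) =
        ∑ x ∈ (hfin z.1).toFinset ×ˢ (hfin z.2).toFinset, F x := by
      intro z _
      rw [coeff_pushforwardFun, coeff_pushforwardFun, Finset.sum_mul_sum, Finset.sum_product]
    rw [Finset.sum_congr rfl hinner, ← Finset.sum_biUnion]
    · refine Finset.sum_congr ?_ fun _ _ => rfl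
      ext x
      simp only [Finset.mem_biUnion, Finset.mem_product, Finset.HasAntidiagonal.mem_antidiagonal,
        mem_fibre_toFinset_iff, hmemU, Prod.exists]
      constructor
      · rintro ⟨z1, z2, hz, ⟨h1, hc1⟩, ⟨h2, hc2⟩⟩
        exact ⟨h1, h2, by rw [hc1, hc2, hz]⟩
      · rintro ⟨h1, h2, hce⟩
        exact ⟨c x.1, c x.2, hce, ⟨h1, rfl⟩, ⟨h2, rfl⟩⟩
    · intro z _ z' _ hzz'
      refine Finset.disjoint_left.2 fun x hxz hxz' => hzz' ?_
      rw [Finset.mem_product, mem_fibre_toFinset_iff, mem_fibre_toFinset_iff] at hxz hxz'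
      exact Prod.ext (hxz.1.2.symm.trans hxz'.1.2) (hxz.2.2.symm.trans hxz'.2.2)
  rw [hL, hR]

/-- The **push-forward** `c_* : R⟦P⟧ → R⟦y_t : t ∈ τ⟧`, `∑_{e ∈ P} a_e x^e ↦ ∑ a_e y^{c e}`, along a
map `c` which is additive on `P` with `c 0 = 0` and has finite fibres on `P` — an `R`-algebra
homomorphism. (Kato uses it for an injection `P → ℕ^s`; for the refinement of a chart one needs
non-injective `c` with finite fibres.) [cite: Kato1994, §3 (proof of Lemma 3.4)] -/
def pushforward (hc0 : c 0 = 0) (hadd : ∀ a ∈ P, ∀ b ∈ P, c (a + b) = c a + c b) :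
    monoidPowerSeries R P →ₐ[R] MvPowerSeries τ R where
  toFun f := pushforwardFun (R := R) c hfin f
  map_one' := by rw [Subalgebra.coe_one, pushforwardFun_one (R := R) c hfin hc0]
  map_mul' f g := by rw [Subalgebra.coe_mul, pushforwardFun_mul (R := R) c hfin hadd f.2 g.2]
  map_zero' := by
    ext e
    simp only [Subalgebra.coe_zero, coeff_pushforwardFun, map_zero, Finset.sum_const_zero]
  map_add' f g := by rw [Subalgebra.coe_add, pushforwardFun_add]
  commutes' r := by
    rw [Subalgebra.coe_algebraMap, MvPowerSeries.algebraMap_apply, Algebra.algebraMap_self,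
      RingHom.id_apply, pushforwardFun_C (R := R) c hfin hc0, MvPowerSeries.algebraMap_apply,
      Algebra.algebraMap_self, RingHom.id_apply]

variable (hc0 : c 0 = 0) (hadd : ∀ a ∈ P, ∀ b ∈ P, c (a + b) = c a + c b)

/-- Coefficients of the push-forward. [cite: Kato1994, §3] -/
theorem coeff_pushforward (f : monoidPowerSeries R P) (e : τ →₀ ℕ) :
    MvPowerSeries.coeff e (pushforward (R := R) c hfin hc0 hadd f) =
      ∑ p ∈ (hfin e).toFinset, MvPowerSeries.coeff p (f : MvPowerSeries σ R) :=
  rfl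

/-- The push-forward of a monomial `x^p`, `p ∈ P`, is the monomial `y^{c p}`.
[cite: Kato1994, §3] -/
theorem pushforward_monomial {p : σ →₀ ℕ} (hp : p ∈ P) (r : R) :
    pushforward (R := R) c hfin hc0 hadd ⟨MvPowerSeries.monomial p r, monomial_mem hp r⟩ =
      MvPowerSeries.monomial (c p) r := by
  classical
  ext e
  rw [coeff_pushforward, Subtype.coe_mk, MvPowerSeries.coeff_monomial]
  by_cases he : e = c p
  · subst he
    rw [if_pos rfl, Finset.sum_eq_single p]
    · rw [MvPowerSeries.coeff_monomial, if_pos rfl]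
    · intro q _ hq
      rw [MvPowerSeries.coeff_monomial, if_neg hq]
    · intro h
      exact (h ((mem_fibre_toFinset_iff c hfin).2 ⟨hp, rfl⟩)).elim
  · rw [if_neg he]
    refine Finset.sum_eq_zero fun q hq => ?_
    rw [MvPowerSeries.coeff_monomial, if_neg]
    rintro rfl
    exact he ((mem_fibre_toFinset_iff c hfin).1 hq).2.symm

/-- The push-forward lands in the completed monoid algebra of the image monoid `c(P)`.
[cite: Kato1994, §3] -/
theorem pushforward_mem {Q : AddSubmonoid (τ →₀ ℕ)} (hQ : ∀ p ∈ P, c p ∈ Q)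
    (f : monoidPowerSeries R P) :
    (pushforward (R := R) c hfin hc0 hadd f : MvPowerSeries τ R) ∈ monoidPowerSeries R Q := by
  intro e he
  rw [coeff_pushforward]
  refine Finset.sum_eq_zero fun p hp => ?_
  obtain ⟨hpP, hce⟩ := (mem_fibre_toFinset_iff c hfin).1 hp
  exact (he (hce ▸ hQ p hpP)).elim

end Pushforward
end monoidPowerSeries
end Literature.RingTheory.MvPowerSeries
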